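import Literature.NumberTheory.Irrationality.Zudilin2014.FirstTaleScaling
import Literature.NumberTheory.Transcendental.OddZetaPartialFractions

/-!
# Zudilin 2014, first tale: integrality of the forms (Lemmas 3–5, Proposition 1)

Topic `Literature/NumberTheory/Irrationality/Zudilin2014` [Zudilin2014ZetaTwo, Section 2 (Lemmas 3–4), Section 3
(Lemma 5, Proposition 1)].  PROVED here, for admissible integer parameters:

* `prod_Ico_add_eq_factorial_mul_choose` — the blocks are integer-valued polynomials:
  `∏_{lo≤i<hi} (t+i) = (hi−lo)! · binom(t+hi−1, hi−lo)` for `t ∈ ℤ` (`Ring.choose` on `ℤ`), so Zudilin's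
  `R_j(t) = (t+b_j)⋯(t+a_j−1)/(a_j−b_j)!` takes integer values at integers (`R1_eval_intCast`);
* **Lemma 3** [cite: Zudilin2014ZetaTwo, Lemma 3]: `D_m · (R(k) − R(ℓ))/(k − ℓ) ∈ ℤ` for `R(t) = binom(t+c, m)`,
  as the divisibility `(k − ℓ) ∣ D_m (binom(k+c,m) − binom(ℓ+c,m))` (`sub_dvd_lcm_mul_choose_sub`; proof by
  Chu–Vandermonde, `Ring.add_choose_eq`);
* **Lemma 4** for the product `R₁` of the three blocks (`sub_dvd_lcm_mul_zR1_sub`);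
* `C_k ∈ ℤ` (`coefC_eq_cast`), `q(a,b) ∈ ℤ` (`formQ_eq_cast`, **Proposition 1**, first inclusion);
* **Lemma 5** in the form needed for `p`: `D_c · P(m) ∈ ℤ` for every integer `m ≥ 1 − a₂*`
  (`polyP_eval_eq_cast`; `c ≥ max_j (a_j − b_j)`), hence `D_c A_ℓ ∈ ℤ` (`coefA_eq_cast`) and
  **`D_{M₁} D_{M₂} p(a,b) ∈ ℤ`** for `M₁ ≥ c, b₄−a₂*−1` and `M₂ ≥ d+1, b₄−a₂*−1` (`formP_eq_cast`,
  **Proposition 1**, second inclusion: `D_{c₁}D_{c₂} p ∈ ℤ`).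
Every integrality statement comes with an EXPLICIT integer mirror (`zR1`, `coefCZ`, `formQZ`, `polyPZ`,
`coefAZ`, `formPZ`) and a cast identity, so downstream `p`-adic statements are about integers.

Cell pub-zeta5 (HONEST FRAMING: systematic search; no irrationality claim unless certified).
-/

noncomputable section

open Polynomial Finset
open Literature.NumberTheory.Transcendental (OddZeta.dvd_lcmUpto)

namespace Literature.NumberTheory.Irrationality.Zudilin2014

/-! ### Integer-valued blocks -/

/-- `zb lo hi t = binom(t+hi−1, hi−lo)`: the integer `∏_{lo≤i<hi}(t+i)/(hi−lo)!` for `t ∈ ℤ`. [cite: Zudilin2014ZetaTwo, Lemma 3 (integer-valued polynomials R(a,b;t))] -/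
def zb (lo hi t : ℤ) : ℤ := Ring.choose (t + hi - 1) (hi - lo).toNat

/-- `∏_{lo ≤ i < hi} (t + i) = (hi−lo)! · binom(t+hi−1, hi−lo)` in `ℤ`, for `lo ≤ hi`. [cite: Zudilin2014ZetaTwo, Lemma 3 (R(k) ∈ ℤ)] -/
theorem prod_Ico_add_eq_factorial_mul_choose (lo hi t : ℤ) (h : lo ≤ hi) :
    ∏ i ∈ Ico lo hi, (t + i) = ((hi - lo).toNat.factorial : ℤ) * zb lo hi t := by
  set m := (hi - lo).toNat with hm
  have himage : Ico lo hi = (range m).image fun j : ℕ => hi - 1 - j := by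
    ext i
    simp only [mem_Ico, mem_image, mem_range]
    constructor
    · rintro ⟨h1, h2⟩; exact ⟨(hi - 1 - i).toNat, by omega, by omega⟩
    · rintro ⟨j, hj, rfl⟩; omega
  have hinj : Set.InjOn (fun j : ℕ => hi - 1 - (j : ℤ)) (range m : Finset ℕ) := by
    intro x _ y _ hxy; have : (x : ℤ) = y := by dsimp at hxy; linarith
    exact_mod_cast this
  rw [himage, prod_image hinj]
  have e : ∏ j ∈ range m, (t + (hi - 1 - (j : ℤ))) = ∏ j ∈ range m, ((t + hi - 1) - j) :=
    prod_congr rfl fun j _ => by ring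
  rw [e, ← descPochhammer_eval_eq_prod_range, eval_eq_smeval, Ring.descPochhammer_eq_factorial_smul_choose,
    nsmul_eq_mul, zb]

/-- Evaluation of a block at an integer: `block lo hi (t) = (hi−lo)! · zb lo hi t`. [cite: Zudilin2014ZetaTwo, Lemma 3 (R(k) ∈ ℤ)] -/
theorem eval_block_intCast (lo hi t : ℤ) (h : lo ≤ hi) :
    (block lo hi).eval (t : ℚ) = ((hi - lo).toNat.factorial : ℚ) * (zb lo hi t : ℚ) := by
  rw [eval_block]
  have e : ∏ i ∈ Ico lo hi, ((t : ℚ) + i) = ((∏ i ∈ Ico lo hi, (t + i) : ℤ) : ℚ) := by push_cast; rfl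
  rw [e, prod_Ico_add_eq_factorial_mul_choose lo hi t h]; push_cast; rfl

/-- The integer value of `R₁` at an integer: `zR1 t = ∏_{j<3} binom(t+a_j−1, a_j−b_j)`. [cite: Zudilin2014ZetaTwo, proof of Lemma 5] -/
def zR1 (a b : Fin 4 → ℤ) (t : ℤ) : ℤ := zb (b 0) (a 0) t * zb (b 1) (a 1) t * zb (b 2) (a 2) t

/-- `facZ m = m.toNat !`. [cite: Zudilin2014ZetaTwo, Section 3, eq. (gc)] -/
theorem facZ_eq (m : ℤ) : facZ m = (m.toNat.factorial : ℚ) := rfl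

/-- **`R₁` is integer-valued** (Lemma 4 setting): `R₁(t) = zR1 t` for `t ∈ ℤ`. [cite: Zudilin2014ZetaTwo, Lemma 4] -/
theorem R1_eval_intCast {a b : Fin 4 → ℤ} (h : Admissible a b) (t : ℤ) :
    (R1 a b).eval (t : ℚ) = (zR1 a b t : ℚ) := by
  have h0 : b 0 ≤ a 0 := h.lower 0 (by decide) 0
  have h1 : b 1 ≤ a 1 := h.lower 1 (by decide) 1
  have h2 : b 2 ≤ a 2 := h.lower 2 (by decide) 2
  unfold R1 num numFac
  rw [eval_mul, eval_C, eval_mul, eval_mul, eval_block_intCast _ _ _ h0, eval_block_intCast _ _ _ h1,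
    eval_block_intCast _ _ _ h2, zR1, facZ_eq, facZ_eq, facZ_eq]
  push_cast
  field_simp

/-! ### Lemma 3: difference quotients of binomial polynomials -/

/-- `j · binom(z, j) = z · binom(z−1, j−1)` in `ℤ` (`j ≥ 1`). [cite: Zudilin2014ZetaTwo, proof of Lemma 3] -/
theorem natCast_mul_choose_eq (z : ℤ) {j : ℕ} (hj : 1 ≤ j) :
    (j : ℤ) * Ring.choose z j = z * Ring.choose (z - 1) (j - 1) := by
  have e := Ring.choose_smul_choose z hj
  rw [Nat.choose_one_right, nsmul_eq_mul, Ring.choose_one_right] at e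
  exact e

/-- **Zudilin 2014, Lemma 3** [cite: Zudilin2014ZetaTwo, Lemma 3] (difference-quotient part), for
`R(t) = binom(t+c, m)`: `D_m · (R(x) − R(y))/(x − y) ∈ ℤ`, stated as `(x − y) ∣ D_m (R(x) − R(y))`.
Proof: Chu–Vandermonde `binom(y+c+z, m) = Σ_{i+j=m} binom(y+c,i) binom(z,j)` and `j ∣ D_m`, `j·binom(z,j) = z·binom(z−1,j−1)`. -/
theorem sub_dvd_lcm_mul_choose_sub (m : ℕ) (x y c : ℤ) :
    (x - y) ∣ (Nat.lcmUpto m : ℤ) * (Ring.choose (x + c) m - Ring.choose (y + c) m) := by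
  set z := x - y with hz
  have hx : x + c = (y + c) + z := by rw [hz]; ring
  rw [hx, Ring.add_choose_eq m (Commute.all _ _)]
  have hmem : (m, 0) ∈ antidiagonal m := by simp
  rw [← add_sum_erase _ _ hmem]
  simp only [Ring.choose_zero_right, mul_one, add_sub_cancel_left, mul_sum]
  refine dvd_sum fun ij hij => ?_
  have hij' := mem_erase.1 hij
  have hsum : ij.1 + ij.2 = m := mem_antidiagonal.1 hij'.2
  have hj1 : 1 ≤ ij.2 := by
    rcases Nat.eq_zero_or_pos ij.2 with h0 | h0
    · exfalso; apply hij'.1; ext <;> simp <;> omega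
    · exact h0
  obtain ⟨q, hq⟩ : (ij.2 : ℤ) ∣ (Nat.lcmUpto m : ℤ) := by
    exact_mod_cast OddZeta.dvd_lcmUpto hj1 (by omega)
  have key : (Nat.lcmUpto m : ℤ) * Ring.choose z ij.2 = q * (z * Ring.choose (z - 1) (ij.2 - 1)) := by
    rw [hq, mul_assoc, ← natCast_mul_choose_eq z hj1]; ring
  rw [← mul_assoc, mul_comm (Nat.lcmUpto m : ℤ), mul_assoc, key]
  exact Dvd.intro (Ring.choose (y + c) ij.1 * q * Ring.choose (z - 1) (ij.2 - 1)) (by ring)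

/-- `D_m ∣ D_M` for `m ≤ M` (in `ℤ`). [cite: Zudilin2014ZetaTwo, proof of Lemma 4 (D_m with m = max)] -/
theorem lcmUpto_dvd_lcmUpto_int {m M : ℕ} (h : m ≤ M) : (Nat.lcmUpto m : ℤ) ∣ (Nat.lcmUpto M : ℤ) := by
  have : Nat.lcmUpto m ∣ Nat.lcmUpto M :=
    Finset.lcm_mono (Finset.Icc_subset_Icc le_rfl h)
  exact_mod_cast this

/-- Lemma 3 for one block of `R₁`: `(x − y) ∣ D_c (zb lo hi x − zb lo hi y)` whenever `hi − lo ≤ c`. [cite: Zudilin2014ZetaTwo, Lemma 3] -/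
theorem sub_dvd_lcm_mul_zb_sub {lo hi : ℤ} {c : ℕ} (hc : (hi - lo).toNat ≤ c) (x y : ℤ) :
    (x - y) ∣ (Nat.lcmUpto c : ℤ) * (zb lo hi x - zb lo hi y) := by
  obtain ⟨q, hq⟩ := lcmUpto_dvd_lcmUpto_int hc
  have h := sub_dvd_lcm_mul_choose_sub (hi - lo).toNat x y (hi - 1)
  rw [hq, mul_comm _ q, mul_assoc]
  refine Dvd.dvd.mul_left ?_ q
  simpa [zb, add_sub] using h

/-- **Zudilin 2014, Lemma 4** [cite: Zudilin2014ZetaTwo, Lemma 4] (difference-quotient part) for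
`R₁ = R_1 R_2 R_3`: `(x − y) ∣ D_c (R₁(x) − R₁(y))` when `c ≥ a_j − b_j` (`j = 1,2,3`). -/
theorem sub_dvd_lcm_mul_zR1_sub {a b : Fin 4 → ℤ} {c : ℕ}
    (hc : ∀ j : Fin 4, j ≠ 3 → (a j - b j).toNat ≤ c) (x y : ℤ) :
    (x - y) ∣ (Nat.lcmUpto c : ℤ) * (zR1 a b x - zR1 a b y) := by
  have h0 := sub_dvd_lcm_mul_zb_sub (hc 0 (by decide)) x y
  have h1 := sub_dvd_lcm_mul_zb_sub (hc 1 (by decide)) x y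
  have h2 := sub_dvd_lcm_mul_zb_sub (hc 2 (by decide)) x y
  have e : (Nat.lcmUpto c : ℤ) * (zR1 a b x - zR1 a b y)
      = (Nat.lcmUpto c : ℤ) * (zb (b 0) (a 0) x - zb (b 0) (a 0) y) * (zb (b 1) (a 1) x * zb (b 2) (a 2) x)
        + (Nat.lcmUpto c : ℤ) * (zb (b 1) (a 1) x - zb (b 1) (a 1) y) * (zb (b 0) (a 0) y * zb (b 2) (a 2) x)
        + (Nat.lcmUpto c : ℤ) * (zb (b 2) (a 2) x - zb (b 2) (a 2) y) * (zb (b 0) (a 0) y * zb (b 1) (a 1) y) := by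
    unfold zR1; ring
  rw [e]
  exact dvd_add (dvd_add (h0.mul_right _) (h1.mul_right _)) (h2.mul_right _)

/-! ### `C_k` and `q` are integers -/

/-- `ε_k` as an integer. [cite: Zudilin2014ZetaTwo, proof of Lemma 5] -/
def epsZ (a b : Fin 4 → ℤ) (k : ℤ) : ℤ :=
  (-1) ^ (k - a 3).toNat * (Nat.choose (b 3 - a 3 - 1).toNat (k - a 3).toNat : ℤ)

/-- `eps k = epsZ k`. [cite: Zudilin2014ZetaTwo, proof of Lemma 5] -/
theorem eps_eq_cast (a b : Fin 4 → ℤ) (k : ℤ) : eps a b k = (epsZ a b k : ℚ) := by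
  unfold eps epsZ; push_cast; rfl

/-- `C_k` as an integer: `ε_k · zR1(−k)`. [cite: Zudilin2014ZetaTwo, eq. (P2)] -/
def coefCZ (a b : Fin 4 → ℤ) (k : ℤ) : ℤ := epsZ a b k * zR1 a b (-k)

/-- **`C_k ∈ ℤ`** [cite: Zudilin2014ZetaTwo, eq. (P2)]: `coefC k = coefCZ k`. -/
theorem coefC_eq_cast {a b : Fin 4 → ℤ} (h : Admissible a b) (k : ℤ) :
    coefC a b k = (coefCZ a b k : ℚ) := by
  unfold coefC coefCZ
  rw [eps_eq_cast, show (-(k : ℚ)) = ((-k : ℤ) : ℚ) by push_cast; ring, R1_eval_intCast h]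
  push_cast; ring

/-- `q(a,b)` as an integer. [cite: Zudilin2014ZetaTwo, Proposition 1] -/
def formQZ (a b : Fin 4 → ℤ) : ℤ := (-1) ^ dExp a b * ∑ k ∈ Ico (amax a) (b 3), coefCZ a b k

/-- **Proposition 1, `q(a,b) ∈ ℤ`** [cite: Zudilin2014ZetaTwo, Proposition 1]: `formQ = formQZ`. -/
theorem formQ_eq_cast {a b : Fin 4 → ℤ} (h : Admissible a b) : formQ a b = (formQZ a b : ℚ) := by
  unfold formQ formQZ
  push_cast
  congr 1
  exact sum_congr rfl fun k _ => coefC_eq_cast h k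

/-! ### Lemma 5: `D_c · P(m) ∈ ℤ` at the Newton nodes -/

/-- If `(X + k)² ∣ F` then `(F − F(−k))/(X+k)` vanishes at `−k`. [cite: Zudilin2014ZetaTwo, proof of Lemma 5] -/
theorem dq_eval_neg_eq_zero {F : ℚ[X]} {k : ℤ} (hF : (X + C (k : ℚ)) ^ 2 ∣ F) :
    (dq F k).eval (-(k : ℚ)) = 0 := by
  obtain ⟨G, hG⟩ := hF
  have hroot : F.eval (-(k : ℚ)) = 0 := by rw [hG]; simp
  have e : (X + C (k : ℚ)) * dq F k = F := by
    have := X_add_mul_dq F k; rwa [hroot, C_0, sub_zero] at this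
  have e2 : (X + C (k : ℚ)) * dq F k = (X + C (k : ℚ)) * ((X + C (k : ℚ)) * G) := by
    rw [e]; rw [hG]; ring
  have e' := mul_left_cancel₀ (monic_X_add_C (k : ℚ)).ne_zero e2
  rw [e']; simp

/-- At a node `m = −k` with `a₄ ≤ k < a₂*` the three numerator blocks all vanish at `−k`:
`(X + k)² ∣ R₁`. [cite: Zudilin2014ZetaTwo, Section 3 (double zeroes of R)] -/
theorem sq_dvd_R1 {a b : Fin 4 → ℤ} (h : Admissible a b) {k : ℤ} (hk : a 3 ≤ k) (hk' : k < a2star a) :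
    (X + C (k : ℚ)) ^ 2 ∣ R1 a b := by
  have h3 : a 3 < a2star a := lt_of_le_of_lt hk hk'
  have hmem : ∀ j : Fin 4, j ≠ 3 → k ∈ Ico (b j) (a j) := fun j hj =>
    mem_Ico.2 ⟨(h.lower j hj 3).trans hk, lt_of_lt_of_le hk' (a2star_le_of_lt h3 hj)⟩
  have hd : ∀ j : Fin 4, j ≠ 3 → (X + C (k : ℚ)) ∣ block (b j) (a j) := fun j hj =>
    dvd_prod_of_mem (fun i : ℤ => (X + C (i : ℚ) : ℚ[X])) (hmem j hj)
  unfold R1 num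
  rw [pow_two]
  exact (((mul_dvd_mul (hd 0 (by decide)) (hd 1 (by decide))).mul_right _).mul_left _)

/-- The integer mirror of `D_c · (dq R₁ k)(m)` (exact division; `0` when `m + k = 0`). [cite: Zudilin2014ZetaTwo, Lemma 5] -/
def dqZ (a b : Fin 4 → ℤ) (c : ℕ) (m k : ℤ) : ℤ :=
  (Nat.lcmUpto c : ℤ) * (zR1 a b m - zR1 a b (-k)) / (m + k)

/-- `D_c · (dq R₁ k)(m) = dqZ` for integers `m ≥ 1 − a₂*` and `a₄ ≤ k < b₄`. [cite: Zudilin2014ZetaTwo, Lemma 5] -/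
theorem dq_eval_eq_cast {a b : Fin 4 → ℤ} (h : Admissible a b) {c : ℕ}
    (hc : ∀ j : Fin 4, j ≠ 3 → (a j - b j).toNat ≤ c) {m k : ℤ} (hm : 1 - a2star a ≤ m)
    (hk : k ∈ Ico (a 3) (b 3)) :
    (Nat.lcmUpto c : ℚ) * (dq (R1 a b) k).eval (m : ℚ) = (dqZ a b c m k : ℚ) := by
  by_cases hmk : m + k = 0
  · have hkm : (m : ℚ) = -(k : ℚ) := by
      have : m = -k := by omega
      rw [this]; push_cast; ring
    have hk' : k < a2star a := by have := (mem_Ico.1 hk).1; omega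
    rw [hkm, dq_eval_neg_eq_zero (sq_dvd_R1 h (mem_Ico.1 hk).1 hk'), mul_zero, dqZ, hmk, Int.ediv_zero,
      Int.cast_zero]
  · have hmk' : (m : ℚ) + k ≠ 0 := by exact_mod_cast hmk
    have e := eval_eq_dq (R1 a b) k (m : ℚ)
    rw [R1_eval_intCast h, show (-(k : ℚ)) = ((-k : ℤ) : ℚ) by push_cast; ring, R1_eval_intCast h] at e
    have hdvd := sub_dvd_lcm_mul_zR1_sub (a := a) (b := b) hc m (-k)
    rw [sub_neg_eq_add] at hdvd
    rw [dqZ, Int.cast_div hdvd (by exact_mod_cast hmk)]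
    push_cast
    field_simp
    linear_combination (-(Nat.lcmUpto c : ℚ)) * e

/-- The integer mirror of `D_c · P(m)`. [cite: Zudilin2014ZetaTwo, Lemma 5] -/
def polyPZ (a b : Fin 4 → ℤ) (c : ℕ) (m : ℤ) : ℤ := ∑ k ∈ Ico (a 3) (b 3), epsZ a b k * dqZ a b c m k

/-- **Zudilin 2014, Lemma 5** [cite: Zudilin2014ZetaTwo, Lemma 5] at the nodes: for `c ≥ a_j − b_j` (`j=1,2,3`)
and every integer `m ≥ 1 − a₂*`, `D_c · P(m) = polyPZ c m ∈ ℤ`. -/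
theorem polyP_eval_eq_cast {a b : Fin 4 → ℤ} (h : Admissible a b) {c : ℕ}
    (hc : ∀ j : Fin 4, j ≠ 3 → (a j - b j).toNat ≤ c) {m : ℤ} (hm : 1 - a2star a ≤ m) :
    (Nat.lcmUpto c : ℚ) * (polyP a b).eval (m : ℚ) = (polyPZ a b c m : ℚ) := by
  unfold polyP polyPZ
  rw [eval_finsetSum, mul_sum]
  push_cast
  refine sum_congr rfl fun k hk => ?_
  rw [eval_mul, eval_C, eps_eq_cast, ← dq_eval_eq_cast h hc hm hk]
  ring

/-- The integer mirror of `D_c · A_ℓ`. [cite: Zudilin2014ZetaTwo, proof of Proposition 1] -/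
def coefAZ (a b : Fin 4 → ℤ) (c : ℕ) (l : ℕ) : ℤ :=
  ∑ i ∈ range (l + 1), (-1) ^ (l - i) * (Nat.choose l i : ℤ) * polyPZ a b c (1 + i - a2star a)

/-- **`D_c A_ℓ ∈ ℤ`** (proof of Proposition 1): `D_c · coefA ℓ = coefAZ c ℓ`. [cite: Zudilin2014ZetaTwo, proof of Proposition 1] -/
theorem coefA_eq_cast {a b : Fin 4 → ℤ} (h : Admissible a b) {c : ℕ}
    (hc : ∀ j : Fin 4, j ≠ 3 → (a j - b j).toNat ≤ c) (l : ℕ) :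
    (Nat.lcmUpto c : ℚ) * coefA a b l = (coefAZ a b c l : ℚ) := by
  unfold coefA coefAZ
  rw [mul_sum]
  push_cast
  refine sum_congr rfl fun i _ => ?_
  have hnode : (1 : ℚ) + i - a2star a = ((1 + i - a2star a : ℤ) : ℚ) := by push_cast; ring
  rw [hnode, ← polyP_eval_eq_cast h hc (by omega)]
  ring

/-! ### Proposition 1: `D_{c₁} D_{c₂} p(a,b) ∈ ℤ` -/

/-- The integer mirror of `D_{M₁} D_{M₂} H₂(K)`: `Σ_{ℓ=1}^{K} (D_{M₁}/ℓ)(D_{M₂}/ℓ)`. [cite: Zudilin2014ZetaTwo, Lemma 2 and Proposition 1 (denominators of Σ ℓ⁻²)] -/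
def harmTwoZ (M₁ M₂ K : ℕ) : ℤ :=
  ∑ l ∈ range K, ((Nat.lcmUpto M₁ : ℤ) / (l + 1)) * ((Nat.lcmUpto M₂ : ℤ) / (l + 1))

/-- `D_{M₁} D_{M₂} H₂(K) = harmTwoZ` for `K ≤ M₁, M₂`. [cite: Zudilin2014ZetaTwo, Proposition 1 (denominators of Σ ℓ⁻²)] -/
theorem harmTwo_eq_cast {M₁ M₂ K : ℕ} (h1 : K ≤ M₁) (h2 : K ≤ M₂) :
    (Nat.lcmUpto M₁ : ℚ) * Nat.lcmUpto M₂ * harmTwo K = (harmTwoZ M₁ M₂ K : ℚ) := by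
  unfold harmTwo harmTwoZ
  rw [mul_sum]
  push_cast
  refine sum_congr rfl fun l hl => ?_
  have hl' := mem_range.1 hl
  have d1 : ((l + 1 : ℕ) : ℤ) ∣ (Nat.lcmUpto M₁ : ℤ) := by exact_mod_cast OddZeta.dvd_lcmUpto (by omega) (by omega)
  have d2 : ((l + 1 : ℕ) : ℤ) ∣ (Nat.lcmUpto M₂ : ℤ) := by exact_mod_cast OddZeta.dvd_lcmUpto (by omega) (by omega)
  have hne : (((l + 1 : ℕ) : ℤ) : ℚ) ≠ 0 := by positivity
  rw [show ((l : ℤ) + 1 : ℤ) = ((l + 1 : ℕ) : ℤ) by push_cast; ring, Int.cast_div d1 hne, Int.cast_div d2 hne]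
  push_cast
  field_simp

/-- The integer mirror of `D_{M₁} D_{M₂} p(a,b)`. [cite: Zudilin2014ZetaTwo, Proposition 1] -/
def formPZ (a b : Fin 4 → ℤ) (M₁ M₂ : ℕ) : ℤ :=
  (-1) ^ dExp a b * (∑ k ∈ Ico (amax a) (b 3), coefCZ a b k * harmTwoZ M₁ M₂ (k - a2star a).toNat
    - ∑ l ∈ range (dExp a b + 1), (-1) ^ l * coefAZ a b M₁ l * ((Nat.lcmUpto M₂ : ℤ) / (l + 1)))

/-- **Zudilin 2014, Proposition 1, `D_{c₁} D_{c₂} p(a,b) ∈ ℤ`** [cite: Zudilin2014ZetaTwo, Proposition 1]: for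
`M₁ ≥ a_j − b_j (j ≤ 3)`, `M₁, M₂ ≥ b₄ − a₂* − 1` and `M₂ ≥ d + 1` (the printed `c₁ = max{a_j−b_j, b₄−a₂*−1}`,
`c₂ = max{d+1, b₄−a₂*−1}` qualify), `D_{M₁} D_{M₂} · p(a,b) = formPZ M₁ M₂ ∈ ℤ`. -/
theorem formP_eq_cast {a b : Fin 4 → ℤ} (h : Admissible a b) {M₁ M₂ : ℕ}
    (hc : ∀ j : Fin 4, j ≠ 3 → (a j - b j).toNat ≤ M₁) (hK₁ : (b 3 - a2star a - 1).toNat ≤ M₁)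
    (hK₂ : (b 3 - a2star a - 1).toNat ≤ M₂) (hd : dExp a b + 1 ≤ M₂) :
    (Nat.lcmUpto M₁ : ℚ) * Nat.lcmUpto M₂ * formP a b = (formPZ a b M₁ M₂ : ℚ) := by
  unfold formP formPZ
  rw [mul_left_comm, mul_sub, mul_sum, mul_sum]
  push_cast
  congr 2
  · refine sum_congr rfl fun k hk => ?_
    have hkb := (mem_Ico.1 hk).2
    have hK : (k - a2star a).toNat ≤ (b 3 - a2star a - 1).toNat := by omega
    rw [coefC_eq_cast h, ← harmTwo_eq_cast (hK.trans hK₁) (hK.trans hK₂)]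
    ring
  · refine sum_congr rfl fun l hl => ?_
    have hl' := mem_range.1 hl
    have d2 : ((l + 1 : ℕ) : ℤ) ∣ (Nat.lcmUpto M₂ : ℤ) := by exact_mod_cast OddZeta.dvd_lcmUpto (by omega) (by omega)
    have hne : (((l + 1 : ℕ) : ℤ) : ℚ) ≠ 0 := by positivity
    rw [← coefA_eq_cast h hc, show ((l : ℤ) + 1 : ℤ) = ((l + 1 : ℕ) : ℤ) by push_cast; ring,
      Int.cast_div d2 hne]
    push_cast
    field_simp

end Literature.NumberTheory.Irrationality.Zudilin2014

end
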